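import Summits.RiemannHypothesis.RiemannHypothesis.Theses.RuelleBand
import Literature.NumberTheory.LFunctions.GeneralizedRH
import Literature.NumberTheory.LFunctions.RHWave0HardyProofs
import Literature.NumberTheory.DiophantineGeometry.NamedHypothesesRHProofs
import Literature.NumberTheory.LFunctions.ZetaArgumentCertificate
import Literature.NumberTheory.LFunctions.RiemannHypothesisUpTo101
import Literature.NumberTheory.LFunctions.RiemannHypothesisUpTo2516
import Literature.Barriers.RiemannHypothesis.PseudoLaplacianSpacing
import Literature.Barriers.RiemannHypothesis.EpsteinZetaRealZerosProofs
import Literature.Barriers.RiemannHypothesis.EpsteinZetaRealZerosDHHolds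
import Literature.Barriers.RiemannHypothesis.EpsteinZetaStark
import Summits.RiemannHypothesis.RiemannHypothesis.Theorems.AsymptoticCriticalLine.Negative.DavenportHeilbronnBand

/-!
# Disproof of `ExactFirstBand` (crux stmt-RiemannHypothesis-2061, route RuelleBand) — standing adversary's work file

Crux (rank 0, thesis X of the route; auto-crux = the undischarged hypothesis of the deciding theorem `closes`):
`ExactFirstBand : Prop := ∀ s : ℂ, riemannZeta s = 0 → 0 < s.re → s.re < 1 → s.re = 1 / 2 ∨ s.im = 0`
("every zero of `ζ` in the open critical strip is on the critical line or on the real axis" — the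
Dyatlov–Faure–Guillarmou first-band shape: DFG 2015 Thm 2, Remark (i), READ (arXiv:1403.0256 p.2): "the fact
that `Δ ≥ 0` on functions impl[ies] that either `λ ∈ −m − n/2 + iℝ` or `λ ∈ [−n−m, −m]`" — reality of the
exceptional resonances comes from a self-adjoint, non-negative Laplacian).

FINDINGS (cycle 1, 2026-08-16; everything below is kernel-checked, sorry-free, axioms {propext, Classical.choice,
Quot.sound}; no `kit compute` job was run — see §1 for why none is meaningful):

* §1 WHY IT RESISTS. `exactFirstBand_iff_strip`, `exactFirstBand_iff_riemannHypothesis`: the disjunct `s.im = 0`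
  is dead weight for `ζ` (`ζ(σ) < 0` on `(0,1)`, tree `ZetaRealAxis`), so X ⟺ `RiemannHypothesisStrip` ⟺ Mathlib's
  `RiemannHypothesis`; `¬X ⟺ ¬RH` (`not_exactFirstBand_iff_not_riemannHypothesis`). A kill is ONE off-line zero
  (`not_exactFirstBand_iff_exists_offLine`), w.l.o.g. in the quadrant `1/2 < σ < 1, t > 0`
  (`not_exactFirstBand_iff_exists_quadrant`; four at a time, `offLine_quadruple`), of height `t > 101` UNCONDITIONALLY with standard axioms (`not_exactFirstBand_iff_exists_above_hundredOne`; RH up to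
  height 101 — and 16, `…_above_sixteen` — are kernel-checked theorems of the tree), `t > 2516` with the `native_decide`
  axioms of the tree's Odlyzko–te Riele certificate (`not_exactFirstBand_iff_exists_above_2516`, computational), and
  `t > 3 000 175 332 800` modulo the named numerical fact `riemannHypothesisUpTo_platt_trudgian`
  (`not_exactFirstBand_iff_exists_above_plattTrudgian`; Platt–Trudgian 2021 Thm 1). X ⟺ ∀ T, RH up to T
  (`exactFirstBand_iff_forall_upTo`): unlike rung #5, a kill IS finitely certifiable — but only above 3·10¹².
  WHY NO MECHANISM BEYOND RUNG #5 IS ON OFFER (route's own why-might-fail, source READ this cycle): Connes 1999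
  p.2 — the global trace formula "is left open and shown (Theorem 5 of section VIII) to be equivalent to the
  validity of the Riemann Hypothesis for all L functions with Grössencharakter"; DFG's reality input is `Δ ≥ 0`
  (arXiv:1403.0256 p.2, Remark (i)), for which the adelic flow offers no counterpart.
* §2 LOAD-BEARING ANALYSIS. Only `riemannZeta s = 0` carries weight: dropping it ⇒ false
  (`exactFirstBand_false_without_zeta`); dropping `0 < s.re` (trivial zeros are real), `s.re < 1` (Euler product:
  no zeros on `σ ≥ 1`) or both ⇒ EQUIVALENT (`exactFirstBandWithoutPos_iff`, `exactFirstBandWithoutLtOne_iff`,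
  `allZerosCriticalOrReal_iff`; also `rightZerosReal_iff`: X ⟺ "zeros with `σ > 1/2` are real"). Disjuncts: drop
  `s.im = 0` ⇒ equivalent (§1); drop `s.re = 1/2` ⇒ FALSE by Hardy (`not_allStripZerosReal`); TIGHTNESS: the
  abscissa `1/2` cannot be moved (`not_exactFirstBand_at_other_line`). Casimir form: X ⟺ `s(1-s) ∈ ℝ` for all strip
  zeros (`exactFirstBand_iff_casimir_real`, `…_ofReal`) — a restatement, no mechanism.
* §3 THE SHAPE IN THE NO-EULER-PRODUCT MODELS. X's verbatim shape is FALSE for the Davenport–Heilbronn quintic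
  (`not_exactFirstBand_shape_davenportHeilbronn`; Saias–Weingartner + identity theorem); its side-condition-free
  forms are FALSE for `ζ_{x²+5y²}` (`not_rightZerosReal_epstein`, `not_allZerosCriticalOrReal_epstein`: a non-real
  zero in `σ > 1`, Davenport–Heilbronn 1936); the real-exceptional clause is LIVE for `ζ_{x²+64y²}`
  (`exists_real_exceptional_zero_epstein`, Bateman–Grosswald); and X's shape IS Stark's theorem for the low zeros of
  `ζ_Q`, `k` large (`exactFirstBand_shape_epstein_low`). MECHANISM behind the model shape: `ζ_Q` is a value of the
  real-analytic Eisenstein series (Chowla–Selberg), dominated for large `k` by its constant term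
  `ζ(2s)y^s + (…)ζ(2s-1)y^{1-s}` (the Lagarias–Suzuki domination used by the tree's proof of Stark's theorem), whose
  zeros lie on `σ = 1/2` (equal moduli of the two terms there = the functional equation, "unitarity of the
  scattering coefficient") or on the real axis near the pole `s = 1` — the DFG shape from self-duality alone, WITH
  real exceptional zeros and WITHOUT RH. (Conductor `1` is no refuge in degree two: `L(s, Δ²)`, level one, exact
  functional equation, integer coefficients, has infinitely many zeros in its half-plane of absolute convergence
  `σ > 25/2` — Conrey–Ghosh 1994 Thm 2, PROVED in tree as `ConreyGhosh1994_thm2_holds`; in degree one Hamburger's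
  theorem makes "`ζ`'s functional equation + Dirichlet series" already imply `F = Cζ`, barrier
  `DavenportHeilbronnNarrow`, scope (a).) Hence the shape transfers no arithmetic:
  for `ζ` the real clause is void and the line clause is RH; a proof must use Euler-product input both at `σ ≥ 1`
  (§2) and against high off-line zeros. Barrier entries engaged: `DavenportHeilbronnNarrow`, `EpsteinZetaRealZeros`
  (both `status: established`, proved in tree). BARRIER NOTE on the route's unfiled step "X ⇐ rung #5 + exceptional
  zeros are real (self-adjointness, as DFG get it from `Δ ≥ 0`)": the one arithmetic incarnation of that mechanism
  in print is the Colin de Verdière / Bombieri–Garrett pseudo-Laplacian on `SL₂(ℤ)\ℍ`, whose discrete spectrum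
  `λ_w = w(1-w) > 1/4` lies among the zeros of `Eθ(w)` (`∝ ζ_k(w)/ζ(2w)`, i.e. the Epstein/Eisenstein world of this
  §3) and is thereby forced onto X's shape — and the catalogued barrier `PseudoLaplacianSpacing` (Bombieri–Garrett
  2020 Thm 67, Cor. 68–69, PROVED in tree as `PseudoLaplacianSpacing_holds` modulo its small-gap input) says such
  spectra are rigidly spaced (`≥ (1-ε)π/log τ`) and so omit a positive proportion of the zeros (≤ 94% on RH + pair
  correlation): the self-adjoint route to the reality clause cannot cover ALL zeros there. The route lists this
  barrier as "not engaged" because X itself names no operator; it becomes engaged the moment the missing step is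
  attempted by self-adjointness on the modular surface. Not engaged: `BerryKeatingOperator`, `ScalingSystemCounting`.
* LANDED COPIES (all ACCEPTED; importable, namespace `Summit.RiemannHypothesis.Cruxes.ExactFirstBand.Negative`, statements
  inline, no defs): `Theorems/ExactFirstBand/Negative/Reformulations.lean` (§1; p81747), `…/Negative/HeightBounds.lean` (§1,
  height 101, kernel only; p87335), `…/Negative/LoadBearing.lean` (§2; p83192), `…/Negative/ModelShapes.lean` (§3 DH quintic,
  Bateman–Grosswald, Stark; p85391) and `…/Negative/ModelShapesClassNumberTwo.lean` (§3 `ζ_{x²+5y²}`; p85408).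
* TARGETS (lead's stuck stubs): none handed over (payload.targets = [], no line picked). NEAR-MISSES: none.
* LITERATURE NEGATIVES: no theorem in print produces an off-line zero of `ζ`; `ledger negatives` has no entry on X;
  numerics: Platt–Trudgian 2021 (RH to 3·10¹², certified), consistent. Sibling dossiers used and CITED:
  `Cruxes/CofiniteCriticalLine/Disproof.lean` §5 (`exactFirstBand_of_riemannHypothesis`,
  `cofiniteCriticalLine_of_exactFirstBand`), `Theorems/CofiniteCriticalLine/Negative/AbstractModels.lean`
  (`not_abstract_cofinite_imp_exact`: rung #5's shape does not give X's shape abstractly),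
  `Theorems/AsymptoticCriticalLine/Negative/Ladder.lean` (`not_exactFirstBand_of_not_acl`) and
  `…/DavenportHeilbronnBand.lean` (the `dhChar` family, imported in §3).
-/

set_option linter.dupNamespace false

noncomputable section

open Complex Set
open scoped ComplexConjugate

namespace Summit.RiemannHypothesis.RiemannHypothesis.Cruxes.ExactFirstBand.Disproof

open Summit.RiemannHypothesis.RiemannHypothesis.Theses.RuelleBand
open Literature.NumberTheory.LFunctions
open Literature.NumberTheory.DiophantineGeometry (RiemannHypothesisUpTo riemannHypothesisUpTo_platt_trudgian
  riemannHypothesisStrip_iff_forall_riemannHypothesisUpTo)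

/-! ## §0 The crux, unfolded (elaboration check: rc 0; `1 / 2 : ℝ`, no junk operators) -/

/-- The crux verbatim. [folklore] -/
theorem exactFirstBand_iff :
    ExactFirstBand ↔ ∀ s : ℂ, riemannZeta s = 0 → 0 < s.re → s.re < 1 → s.re = 1 / 2 ∨ s.im = 0 :=
  Iff.rfl

/-! ## §1 WHY IT RESISTS: X is the Riemann Hypothesis -/

/-- The disjunct `s.im = 0` is DEAD WEIGHT for `ζ`: a zero of the open strip is never real
(`ζ(σ) < 0` on `(0,1)`, tree `riemannZeta_ne_zero_of_im_eq_zero_of_pos_of_lt_one`), so X is verbatim the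
strip form of RH (`Literature.NumberTheory.LFunctions.RiemannHypothesisStrip`). [folklore] -/
theorem exactFirstBand_iff_strip : ExactFirstBand ↔ RiemannHypothesisStrip := by
  refine ⟨fun h s hs h0 h1 => ?_, fun h s hs h0 h1 => Or.inl (h s hs h0 h1)⟩
  exact (h s hs h0 h1).resolve_right (im_ne_zero_of_riemannZeta_eq_zero hs h0 h1)

/-- X ⟺ Mathlib's `RiemannHypothesis` (kill criterion (iv) of the route as a Lean theorem: a disproof of the
crux is a disproof of RH). [folklore] -/
theorem exactFirstBand_iff_riemannHypothesis : ExactFirstBand ↔ RiemannHypothesis :=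
  exactFirstBand_iff_strip.trans (riemannHypothesis_iff_strip_holds : RiemannHypothesis ↔ _).symm

/-- Hence `¬X ⟺ ¬RH`. [folklore] -/
theorem not_exactFirstBand_iff_not_riemannHypothesis : ¬ ExactFirstBand ↔ ¬ RiemannHypothesis :=
  not_congr exactFirstBand_iff_riemannHypothesis

/-- COUNTEREXAMPLE NORMAL FORM (1): a kill is exactly one off-line zero of the open strip; it is then
automatically non-real. [folklore] -/
theorem not_exactFirstBand_iff_exists_offLine :
    ¬ ExactFirstBand ↔ ∃ s : ℂ, riemannZeta s = 0 ∧ 0 < s.re ∧ s.re < 1 ∧ s.re ≠ 1 / 2 ∧ s.im ≠ 0 := by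
  constructor
  · intro h
    by_contra hne
    apply h
    intro s hs h0 h1
    by_contra hor
    push Not at hor
    exact hne ⟨s, hs, h0, h1, hor.1, hor.2⟩
  · rintro ⟨s, hs, h0, h1, hne, him⟩ h
    rcases h s hs h0 h1 with h' | h'
    exacts [hne h', him h']

/-- COUNTEREXAMPLE NORMAL FORM (2): by the symmetries `s ↦ 1 - s` (functional equation, tree
`GeneralizedRH.riemannZeta_one_sub_eq_zero`) and `s ↦ conj s` (Mathlib `riemannZeta_conj`) of the zero set,
a kill may be sought in the open quadrant `1/2 < re s < 1`, `im s > 0` only. [folklore] -/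
theorem not_exactFirstBand_iff_exists_quadrant :
    ¬ ExactFirstBand ↔ ∃ s : ℂ, riemannZeta s = 0 ∧ 1 / 2 < s.re ∧ s.re < 1 ∧ 0 < s.im := by
  rw [not_exactFirstBand_iff_exists_offLine]
  constructor
  · rintro ⟨s, hs, h0, h1, hne, him⟩
    obtain ⟨u, hu, hu0, hu1, huim⟩ :
        ∃ u : ℂ, riemannZeta u = 0 ∧ 1 / 2 < u.re ∧ u.re < 1 ∧ u.im ≠ 0 := by
      rcases lt_or_gt_of_ne hne with hlt | hgt
      · refine ⟨1 - s, GeneralizedRH.riemannZeta_one_sub_eq_zero hs h0 h1, ?_, ?_, ?_⟩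
        · simp only [sub_re, one_re]; linarith
        · simp only [sub_re, one_re]; linarith
        · simpa [sub_im] using him
      · exact ⟨s, hs, hgt, h1, him⟩
    rcases lt_or_gt_of_ne huim with hneg | hpos
    · refine ⟨conj u, ?_, ?_, ?_, ?_⟩
      · rw [riemannZeta_conj, hu, map_zero]
      · simpa using hu0
      · simpa using hu1
      · rw [conj_im]; linarith
    · exact ⟨u, hu, hu0, hu1, hpos⟩
  · rintro ⟨s, hs, h0, h1, him⟩
    exact ⟨s, hs, by linarith, h1, by intro h; linarith, him.ne'⟩

/-- COUNTEREXAMPLE STRUCTURE: a kill `s` brings three more — `conj s`, `1 - s`, `1 - conj s` — and the four are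
pairwise distinct (off the line and off the axis the Klein four-group of symmetries acts freely). [cite: Titchmarsh1986, §2.12] -/
theorem offLine_quadruple {s : ℂ} (hs : riemannZeta s = 0) (h0 : 0 < s.re) (h1 : s.re < 1)
    (hne : s.re ≠ 1 / 2) :
    (riemannZeta (conj s) = 0 ∧ riemannZeta (1 - s) = 0 ∧ riemannZeta (1 - conj s) = 0) ∧
      s ≠ conj s ∧ s ≠ 1 - s ∧ s ≠ 1 - conj s ∧ conj s ≠ 1 - s ∧ conj s ≠ 1 - conj s ∧
        1 - s ≠ 1 - conj s := by
  have him : s.im ≠ 0 := im_ne_zero_of_riemannZeta_eq_zero hs h0 h1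
  have hc : riemannZeta (conj s) = 0 := by rw [riemannZeta_conj, hs, map_zero]
  have h1s : riemannZeta (1 - s) = 0 := GeneralizedRH.riemannZeta_one_sub_eq_zero hs h0 h1
  have h1c : riemannZeta (1 - conj s) = 0 :=
    GeneralizedRH.riemannZeta_one_sub_eq_zero hc (by simpa using h0) (by simpa using h1)
  refine ⟨⟨hc, h1s, h1c⟩, ?_, ?_, ?_, ?_, ?_, ?_⟩ <;> intro h
  · have := congrArg Complex.im h
    rw [conj_im] at this
    exact him (by linarith)
  · have := congrArg Complex.re h
    rw [sub_re, one_re] at this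
    exact hne (by linarith)
  · have := congrArg Complex.re h
    rw [sub_re, one_re, conj_re] at this
    exact hne (by linarith)
  · have := congrArg Complex.re h
    rw [conj_re, sub_re, one_re] at this
    exact hne (by linarith)
  · have := congrArg Complex.re h
    rw [sub_re, one_re, conj_re] at this
    exact hne (by linarith)
  · have := congrArg Complex.im h
    rw [sub_im, one_im, sub_im, one_im, conj_im] at this
    exact him (by linarith)

/-- X ⟺ "RH up to every height `T`" (`RiemannHypothesisUpTo T`: every zero with `0 < im s ≤ T` has
`re s = 1/2`; tree `riemannHypothesisStrip_iff_forall_riemannHypothesisUpTo`). A kill is a failure of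
numerical RH verification at SOME finite height — certifiable by a finite computation if it exists (argument
principle in ball arithmetic), unlike rung #5 `CofiniteCriticalLine`, which no finite computation refutes.
[folklore] -/
theorem exactFirstBand_iff_forall_upTo : ExactFirstBand ↔ ∀ T : ℝ, RiemannHypothesisUpTo T :=
  exactFirstBand_iff_strip.trans riemannHypothesisStrip_iff_forall_riemannHypothesisUpTo

/-- BOUNDED SEARCH, KERNEL-CHECKED: there is no counterexample of height `≤ 16` — RH up to height 16 is a
THEOREM of the tree (`riemannHypothesisUpTo_sixteen`, Backlund's certificate `N(16) = 1 = N₀(16)` checked by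
the kernel), extended to negative heights by conjugation and to height `0` by `ζ(σ) < 0` on `(0,1)`.
[cite: Edwards1974, §6.6] -/
theorem re_eq_half_of_abs_im_le_sixteen {s : ℂ} (hs : riemannZeta s = 0) (h0 : 0 < s.re) (h1 : s.re < 1)
    (h16 : |s.im| ≤ 16) : s.re = 1 / 2 := by
  rcases lt_trichotomy s.im 0 with him | him | him
  · exact riemannHypothesisUpTo_sixteen.re_eq_of_im_neg hs him (by rwa [abs_of_neg him] at h16)
  · exact absurd hs (riemannZeta_ne_zero_of_im_eq_zero_of_pos_of_lt_one him h0 h1)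
  · exact riemannHypothesisUpTo_sixteen s hs him (by rwa [abs_of_pos him] at h16)

/-- COUNTEREXAMPLE NORMAL FORM (3, unconditional): a kill is a zero with `1/2 < re s < 1` and `im s > 16`.
[cite: Edwards1974, §6.6] -/
theorem not_exactFirstBand_iff_exists_above_sixteen :
    ¬ ExactFirstBand ↔ ∃ s : ℂ, riemannZeta s = 0 ∧ 1 / 2 < s.re ∧ s.re < 1 ∧ 16 < s.im := by
  rw [not_exactFirstBand_iff_exists_quadrant]
  constructor
  · rintro ⟨s, hs, h0, h1, him⟩
    refine ⟨s, hs, h0, h1, ?_⟩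
    by_contra hle
    have := re_eq_half_of_abs_im_le_sixteen hs (by linarith) h1
      (by rw [abs_of_pos him]; exact not_lt.1 hle)
    linarith
  · rintro ⟨s, hs, h0, h1, him⟩
    exact ⟨s, hs, h0, h1, by linarith⟩

/-- Generic: RH up to height `T` gives `re s = 1/2` for every zero of the open strip with `|im s| ≤ T`. [folklore] -/
theorem re_eq_half_of_abs_im_le {T : ℝ} (hT : RiemannHypothesisUpTo T) {s : ℂ} (hs : riemannZeta s = 0)
    (h0 : 0 < s.re) (h1 : s.re < 1) (hle : |s.im| ≤ T) : s.re = 1 / 2 := by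
  rcases lt_trichotomy s.im 0 with him | him | him
  · exact hT.re_eq_of_im_neg hs him (by rwa [abs_of_neg him] at hle)
  · exact absurd hs (riemannZeta_ne_zero_of_im_eq_zero_of_pos_of_lt_one him h0 h1)
  · exact hT s hs him (by rwa [abs_of_pos him] at hle)

/-- Generic counterexample normal form above a verified height `T`: `¬X ⟺` a zero with `1/2 < re s < 1`,
`im s > T` (reflection `s ↦ 1 - s` and conjugation move any off-line zero into the quadrant). [folklore] -/
theorem not_exactFirstBand_iff_exists_above {T : ℝ} (hT : RiemannHypothesisUpTo T) :
    ¬ ExactFirstBand ↔ ∃ s : ℂ, riemannZeta s = 0 ∧ 1 / 2 < s.re ∧ s.re < 1 ∧ T < s.im := by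
  constructor
  · intro h
    by_contra hne
    apply h
    intro s hs h0 h1
    by_contra hor
    push Not at hor
    obtain ⟨hhalf, him⟩ := hor
    -- move to the quadrant
    obtain ⟨u, hu, hu0, hu1, huim⟩ :
        ∃ u : ℂ, riemannZeta u = 0 ∧ 1 / 2 < u.re ∧ u.re < 1 ∧ 0 < u.im := by
      obtain ⟨w, hw, hw0, hw1, hwim⟩ :
          ∃ w : ℂ, riemannZeta w = 0 ∧ 1 / 2 < w.re ∧ w.re < 1 ∧ w.im ≠ 0 := by
        rcases lt_or_gt_of_ne hhalf with hlt | hgt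
        · refine ⟨1 - s, GeneralizedRH.riemannZeta_one_sub_eq_zero hs h0 h1, ?_, ?_, ?_⟩
          · simp only [sub_re, one_re]; linarith
          · simp only [sub_re, one_re]; linarith
          · simpa [sub_im] using him
        · exact ⟨s, hs, hgt, h1, him⟩
      rcases lt_or_gt_of_ne hwim with hneg | hpos
      · refine ⟨starRingEnd ℂ w, ?_, ?_, ?_, ?_⟩
        · rw [riemannZeta_conj, hw, map_zero]
        · simpa using hw0
        · simpa using hw1
        · rw [conj_im]; linarith
      · exact ⟨w, hw, hw0, hw1, hpos⟩
    refine hne ⟨u, hu, hu0, hu1, ?_⟩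
    by_contra hle
    have := re_eq_half_of_abs_im_le hT hu (by linarith) hu1 (by rw [abs_of_pos huim]; exact not_lt.1 hle)
    linarith
  · rintro ⟨s, hs, h0, h1, -⟩ h
    rcases h s hs (by linarith) h1 with h' | h'
    · linarith
    · -- a real zero in the open strip does not exist
      exact absurd hs (riemannZeta_ne_zero_of_im_eq_zero_of_pos_of_lt_one h' (by linarith) h1)

/-- BOUNDED SEARCH, KERNEL-CHECKED, height `101` (tree `riemannHypothesisUpTo_hundredOne`: `N(101) = 29 = N₀(101)`,
Backlund certificate + Turing reduction, standard axioms): UNCONDITIONALLY a kill has `1/2 < re s < 1`, `im s > 101`.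
[cite: Edwards1974, §6.6] -/
theorem not_exactFirstBand_iff_exists_above_hundredOne :
    ¬ ExactFirstBand ↔ ∃ s : ℂ, riemannZeta s = 0 ∧ 1 / 2 < s.re ∧ s.re < 1 ∧ 101 < s.im :=
  not_exactFirstBand_iff_exists_above riemannHypothesisUpTo_hundredOne

/-- BOUNDED SEARCH, height `2516` (tree `riemannHypothesisUpTo_2516`: the 2000 Odlyzko–te Riele zeros recomputed and
certified in the tree — COMPUTATIONAL: depends on the `native_decide` auxiliary axioms of the compiled certificate
chunks, `Lean.ofReduceBool` family): a kill has `1/2 < re s < 1`, `im s > 2516`. [cite: OdlyzkoTeRiele1985, §4.2 p. 151] -/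
theorem not_exactFirstBand_iff_exists_above_2516 :
    ¬ ExactFirstBand ↔ ∃ s : ℂ, riemannZeta s = 0 ∧ 1 / 2 < s.re ∧ s.re < 1 ∧ 2516 < s.im :=
  not_exactFirstBand_iff_exists_above riemannHypothesisUpTo_2516

/-- COUNTEREXAMPLE NORMAL FORM (4, modulo the named numerical fact `riemannHypothesisUpTo_platt_trudgian` =
Platt–Trudgian 2021, Thm 1, RH up to height `3 000 175 332 800`, 7.5·10⁶ core-hours of certified ball
arithmetic): a kill is a zero with `1/2 < re s < 1` and `im s > 3 000 175 332 800`. No `kit compute`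
counterexample search below that height is meaningful, and none above it is feasible; none was run.
[cite: PlattTrudgianBLMS2021, Theorem 1] -/
theorem not_exactFirstBand_iff_exists_above_plattTrudgian (hPT : riemannHypothesisUpTo_platt_trudgian) :
    ¬ ExactFirstBand ↔
      ∃ s : ℂ, riemannZeta s = 0 ∧ 1 / 2 < s.re ∧ s.re < 1 ∧ (3000175332800 : ℝ) < s.im := by
  rw [not_exactFirstBand_iff_exists_quadrant]
  constructor
  · rintro ⟨s, hs, h0, h1, him⟩
    refine ⟨s, hs, h0, h1, ?_⟩
    by_contra hle
    have := hPT s hs him (not_lt.1 hle)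
    linarith
  · rintro ⟨s, hs, h0, h1, him⟩
    exact ⟨s, hs, h0, h1, by linarith⟩

/-! ## §2 LOAD-BEARING ANALYSIS: only `riemannZeta s = 0` carries weight -/

/-- X with the hypothesis `riemannZeta s = 0` dropped. [folklore] -/
def ExactFirstBandWithoutZeta : Prop :=
  ∀ s : ℂ, 0 < s.re → s.re < 1 → s.re = 1 / 2 ∨ s.im = 0

/-- Dropping `riemannZeta s = 0` ⇒ FALSE (sanity; witness `1/4 + i`). [folklore] -/
theorem exactFirstBand_false_without_zeta : ¬ ExactFirstBandWithoutZeta := by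
  intro h
  rcases h ⟨1 / 4, 1⟩ (by norm_num) (by norm_num) with h | h <;> norm_num at h

/-- X with the hypothesis `0 < s.re` dropped. [folklore] -/
def ExactFirstBandWithoutPos : Prop :=
  ∀ s : ℂ, riemannZeta s = 0 → s.re < 1 → s.re = 1 / 2 ∨ s.im = 0

/-- Dropping `0 < s.re` gives an EQUIVALENT statement: the zeros with `re s ≤ 0` are the trivial zeros
`-2(n+1)` (tree `riemannZeta_eq_zero_iff_of_re_nonpos`, functional equation), which are REAL — the DFG
"real exceptional resonances" clause absorbs them. `0 < s.re` is decoration. [folklore] -/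
theorem exactFirstBandWithoutPos_iff : ExactFirstBandWithoutPos ↔ ExactFirstBand := by
  refine ⟨fun h s hs _ h1 => h s hs h1, fun h s hs h1 => ?_⟩
  rcases lt_or_ge 0 s.re with h0 | h0
  · exact h s hs h0 h1
  · obtain ⟨n, rfl⟩ := (riemannZeta_eq_zero_iff_of_re_nonpos h0).1 hs
    exact Or.inr (by simp)

/-- X with the hypothesis `s.re < 1` dropped. [folklore] -/
def ExactFirstBandWithoutLtOne : Prop :=
  ∀ s : ℂ, riemannZeta s = 0 → 0 < s.re → s.re = 1 / 2 ∨ s.im = 0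

/-- Dropping `s.re < 1` gives an EQUIVALENT statement (no zeros on `re s ≥ 1`, Mathlib
`riemannZeta_ne_zero_of_one_le_re` — Hadamard–de la Vallée Poussin, via the EULER PRODUCT; this is exactly the
step that fails for the Epstein/Davenport–Heilbronn models of §3). `s.re < 1` is decoration. [folklore] -/
theorem exactFirstBandWithoutLtOne_iff : ExactFirstBandWithoutLtOne ↔ ExactFirstBand := by
  refine ⟨fun h s hs h0 _ => h s hs h0, fun h s hs h0 => ?_⟩
  rcases lt_or_ge s.re 1 with h1 | h1
  · exact h s hs h0 h1
  · exact absurd hs (riemannZeta_ne_zero_of_one_le_re h1)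

/-- X with BOTH strip conditions dropped: "every zero of (Mathlib's) `riemannZeta` is critical or real".
[folklore] -/
def AllZerosCriticalOrReal : Prop :=
  ∀ s : ℂ, riemannZeta s = 0 → s.re = 1 / 2 ∨ s.im = 0

/-- … is again EQUIVALENT to X (and to RH): the cleanest side-condition-free form of the crux. (Mathlib's
junk value `riemannZeta 1 = (γ - log 4π)/2` is irrelevant: `1` is real.) [folklore] -/
theorem allZerosCriticalOrReal_iff : AllZerosCriticalOrReal ↔ ExactFirstBand := by
  refine ⟨fun h s hs _ _ => h s hs, fun h s hs => ?_⟩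
  rcases lt_or_ge 0 s.re with h0 | h0
  · rcases lt_or_ge s.re 1 with h1 | h1
    · exact h s hs h0 h1
    · exact absurd hs (riemannZeta_ne_zero_of_one_le_re h1)
  · obtain ⟨n, rfl⟩ := (riemannZeta_eq_zero_iff_of_re_nonpos h0).1 hs
    exact Or.inr (by simp)

/-- Side-condition-free form on the RIGHT half-plane: "every zero with `re s > 1/2` is real" — EQUIVALENT to
X (reflect the left half of the strip by `s ↦ 1 - s`). This is the form killed for Epstein zeta functions of
class number `> 1` in §3. [folklore] -/
def RightZerosReal : Prop :=
  ∀ s : ℂ, riemannZeta s = 0 → 1 / 2 < s.re → s.im = 0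

/-- [folklore] -/
theorem rightZerosReal_iff : RightZerosReal ↔ ExactFirstBand := by
  constructor
  · intro h
    by_contra hX
    obtain ⟨s, hs, h0, -, him⟩ := not_exactFirstBand_iff_exists_quadrant.1 hX
    exact absurd (h s hs h0) him.ne'
  · intro hX s hs h
    rcases lt_or_ge s.re 1 with h1 | h1
    · rcases hX s hs (by linarith) h1 with h' | h'
      · exact absurd h' (by intro h''; linarith)
      · exact h'
    · exact absurd hs (riemannZeta_ne_zero_of_one_le_re h1)

/-! ### The disjuncts -/

/-- Dropping the disjunct `s.im = 0` gives `RiemannHypothesisStrip` — EQUIVALENT (§1,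
`exactFirstBand_iff_strip`). Dropping the disjunct `s.re = 1 / 2` ("all strip zeros are real") is FALSE by
Hardy's theorem (infinitely many zeros ON the line, tree `hardy_infinite_zeros_on_critical_line_holds`, proved):
some `1/2 + it`, `t ≠ 0`, is a zero. [cite: Hardy1914, C. R. Acad. Sci. Paris 158] -/
def AllStripZerosReal : Prop :=
  ∀ s : ℂ, riemannZeta s = 0 → 0 < s.re → s.re < 1 → s.im = 0

/-- A zero ON the critical line with non-zero ordinate exists (Hardy; proved in tree). [cite: Hardy1914, C. R. Acad. Sci. Paris 158] -/
theorem exists_zero_on_line : ∃ t : ℝ, t ≠ 0 ∧ riemannZeta (1 / 2 + t * I) = 0 := by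
  obtain ⟨t, ht, ht0⟩ := hardy_infinite_zeros_on_critical_line_holds.exists_notMem_finset {0}
  exact ⟨t, by simpa using ht0, ht⟩

/-- [cite: Hardy1914, C. R. Acad. Sci. Paris 158] -/
theorem not_allStripZerosReal : ¬ AllStripZerosReal := by
  intro h
  obtain ⟨t, ht0, ht⟩ := exists_zero_on_line
  have := h _ ht (by norm_num) (by norm_num)
  exact ht0 (by simpa using this)

/-- TIGHTNESS OF THE ABSCISSA: X with `1/2` replaced by any `σ₀ ≠ 1/2` is FALSE (a Hardy zero is neither on
`re s = σ₀` nor real). The constant `1/2` is forced; no "other first band" statement is available. [folklore] -/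
theorem not_exactFirstBand_at_other_line {σ₀ : ℝ} (hσ : σ₀ ≠ 1 / 2) :
    ¬ ∀ s : ℂ, riemannZeta s = 0 → 0 < s.re → s.re < 1 → s.re = σ₀ ∨ s.im = 0 := by
  intro h
  obtain ⟨t, ht0, ht⟩ := exists_zero_on_line
  rcases h _ ht (by norm_num) (by norm_num) with h' | h'
  · exact hσ (by norm_num at h'; exact h'.symm)
  · exact ht0 (by simpa using h')

/-- CASIMIR FORM (the route's own gloss "the Casimir parameter `s(1-s)` is real"): X ⟺ every zero of the open
strip has `(s(1-s)).im = 0` (tree lemma `Literature.Barriers.RiemannHypothesis.mul_one_sub_im_eq_zero_iff`).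
In DFG, reality of `s(1-s)` comes from a SELF-ADJOINT Laplacian (`Δ ≥ 0`); for `ζ` an operator with spectrum
`{ρ(1-ρ)}` that is self-adjoint is Hilbert–Pólya for `λ = ρ(1-ρ)`, i.e. X again — no mechanism is gained by
the reformulation (barrier `PseudoLaplacianSpacing` records the one printed attempt, Colin de Verdière's
pseudo-Laplacian, and why it yields only the zeros it is fed). [folklore] -/
theorem exactFirstBand_iff_casimir_real :
    ExactFirstBand ↔ ∀ s : ℂ, riemannZeta s = 0 → 0 < s.re → s.re < 1 → (s * (1 - s)).im = 0 := by
  simp only [exactFirstBand_iff, Literature.Barriers.RiemannHypothesis.mul_one_sub_im_eq_zero_iff]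

/-- … equivalently `s(1-s)` is a real number `λ` (and then `λ = 1/4 + (im s)^2 ≥ 1/4` on the line: the
"first band" sits above the bottom of the continuous spectrum, as in DFG/Selberg). [folklore] -/
theorem exactFirstBand_iff_casimir_ofReal :
    ExactFirstBand ↔ ∀ s : ℂ, riemannZeta s = 0 → 0 < s.re → s.re < 1 → ∃ μ : ℝ, s * (1 - s) = μ := by
  rw [exactFirstBand_iff_casimir_real]
  refine forall₄_congr fun s _ _ _ => ⟨fun h => ⟨(s * (1 - s)).re, ?_⟩, ?_⟩
  · exact Complex.ext (by simp) (by simp [h])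
  · rintro ⟨l, hl⟩
    rw [hl, ofReal_im]

/-! ## §3 THE SHAPE OF X IN THE NO-EULER-PRODUCT MODELS (all unconditional, all in-tree theorems)

The DFG shape "critical line ∪ real axis" is tested on the two classical families with a Riemann-type
functional equation and no Euler product. Verdict: the shape HOLDS for the low zeros of Epstein zeta
functions with the real clause genuinely populated (Stark 1967 + Bateman–Grosswald 1964, both PROVED in the
tree), and FAILS globally (Davenport–Heilbronn 1936 for `ζ_Q` with `h(d) > 1`, zeros in `σ > 1`, PROVED; the
Davenport–Heilbronn quintic `f`, `≫ T` zeros in `3/4 < σ < 1` by Saias–Weingartner, PROVED). So the shape by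
itself carries no arithmetic: for `ζ` the real clause is void (§1) and what is left is RH; any proof of X must
use Euler-product input twice — to empty `σ ≥ 1` (Mathlib `riemannZeta_ne_zero_of_one_le_re`, §2) and to
exclude the high off-line zeros. Barrier entries engaged: `DavenportHeilbronn(Narrow)`, `EpsteinZetaRealZeros`.
-/

section Models

open Literature.Barriers.RiemannHypothesis
open Summit.RiemannHypothesis.RiemannHypothesis.Theorems.AsymptoticCriticalLine.Negative
  (dhChar dhWeight dhChar_isPrimitive dhSigma_injective dhP_ok dh_sum_eq)
open Filter Topology

/-- MODEL KILL 1 (verbatim shape of X, `davenportHeilbronn` for `riemannZeta`): the Davenport–Heilbronn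
function `f` (entire, `5`-periodic coefficients, odd conductor-`5` Riemann-type functional equation,
infinitely many zeros ON `σ = 1/2`) violates X's shape in the open strip. Proof: Saias–Weingartner (tree,
PROVED) gives `≥ cT` zeros with `3/4 < σ < 1`, `|t| ≤ T`; under the shape they are all real, hence infinitely
many zeros in the compact segment `[3/4, 1]`, so `f ≡ 0` by the identity theorem — but then `f(3/4 + i) = 0`
violates the shape. [cite: Titchmarsh1986, §10.25] [cite: SaiasWeingartner2009, Thm. 2] -/
theorem not_exactFirstBand_shape_davenportHeilbronn :
    ¬ ∀ s : ℂ, davenportHeilbronn s = 0 → 0 < s.re → s.re < 1 → s.re = 1 / 2 ∨ s.im = 0 := by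
  intro hX
  obtain ⟨η, _, hstrip⟩ :=
    SaiasWeingartner_holds Bool (fun _ => 5) dhChar (fun b => dhWeight b • LSeries.delta) (by simp)
      dhChar_isPrimitive dhSigma_injective dhP_ok
  obtain ⟨c, hc, T₀, hT⟩ := hstrip (3 / 4) 1 (by norm_num) (by norm_num) (by linarith)
  set S : Set ℂ := {s : ℂ | davenportHeilbronn s = 0 ∧ 3 / 4 ≤ s.re ∧ s.re ≤ 1 ∧ s.im = 0} with hS
  have hinf : S.Infinite := by
    intro hfin
    set N : ℕ := hfin.toFinset.card with hN
    obtain ⟨Z, hZcard, hZ⟩ := hT (max T₀ (((N : ℝ) + 1) / c)) (le_max_left _ _)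
    have hZsub : ∀ s ∈ Z, s ∈ S := by
      intro s hs
      obtain ⟨h1, h2, _, h4⟩ := hZ s hs
      rw [dh_sum_eq] at h4
      refine ⟨h4, h1.le, h2.le, ?_⟩
      rcases hX s h4 (by linarith) h2 with h | h
      · exfalso; linarith
      · exact h
    have hcard : Z.card ≤ N :=
      Finset.card_le_card fun s hs => (Set.Finite.mem_toFinset hfin).2 (hZsub s hs)
    have hge : (N : ℝ) + 1 ≤ c * max T₀ (((N : ℝ) + 1) / c) :=
      calc (N : ℝ) + 1 = c * (((N : ℝ) + 1) / c) := by field_simp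
        _ ≤ c * max T₀ (((N : ℝ) + 1) / c) := by gcongr; exact le_max_right _ _
    have h1 : (N : ℝ) + 1 ≤ Z.card := hge.trans hZcard
    have h2 : (Z.card : ℝ) ≤ N := by exact_mod_cast hcard
    linarith
  have hK : IsCompact (Icc (3 / 4 : ℝ) 1 ×ℂ Icc (0 : ℝ) 0) := isCompact_Icc.reProdIm isCompact_Icc
  have hsub : S ⊆ Icc (3 / 4 : ℝ) 1 ×ℂ Icc (0 : ℝ) 0 := by
    rintro s ⟨-, h1, h2, h3⟩
    exact Complex.mem_reProdIm.2 ⟨⟨h1, h2⟩, by simp [h3]⟩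
  obtain ⟨z, -, hz⟩ := hinf.exists_accPt_of_subset_isCompact hK hsub
  have hfreq : ∃ᶠ w in 𝓝[≠] z, davenportHeilbronn w = 0 :=
    (accPt_iff_frequently_nhdsNE.mp hz).mono fun w hw => hw.1
  have han : AnalyticOnNhd ℂ davenportHeilbronn Set.univ := fun w _ =>
    differentiable_davenportHeilbronn.analyticAt w
  have h0 : davenportHeilbronn (3 / 4 + I) = 0 :=
    han.eqOn_zero_of_preconnected_of_frequently_eq_zero isPreconnected_univ (Set.mem_univ z) hfreq
      (Set.mem_univ _)
  rcases hX _ h0 (by norm_num) (by norm_num) with h | h <;> norm_num at h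

/-- `h(-20) = 2` in the tree's vocabulary: `x² + 5y²` and `2x² + 2xy + 3y²` have discriminant `-20` and are not
properly equivalent (`2 = p² + 5r²` has no integer solution). [folklore] -/
theorem twoFormClasses_neg_twenty : TwoFormClasses (-20) := by
  refine ⟨(1, 0, 5), (2, 2, 3), by norm_num, by norm_num, by decide, by decide, ?_⟩
  rintro ⟨p, q, r, s, -, h1, -, -⟩
  have h1' : p ^ 2 + 5 * r ^ 2 = 2 := by simp only at h1; linarith
  have hr0 : r ≤ 0 := by nlinarith [sq_nonneg p, sq_nonneg (r - 1)]
  have hr1 : 0 ≤ r := by nlinarith [sq_nonneg p, sq_nonneg (r + 1)]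
  have hr : r = 0 := le_antisymm hr0 hr1
  subst hr
  have hp0 : p ≤ 1 := by nlinarith [sq_nonneg (p - 2)]
  have hp1 : -1 ≤ p := by nlinarith [sq_nonneg (p + 2)]
  interval_cases p <;> norm_num at h1'

/-- `-20 = 4·(-5)` is a fundamental discriminant. [folklore] -/
theorem isFundamentalDiscriminant_neg_twenty : IsFundamentalDiscriminant (-20) :=
  Or.inr ⟨by decide, by decide, by
    have h : Prime (5 : ℤ) := Int.prime_iff_natAbs_prime.2 (by norm_num)
    simpa using (Prime.neg h).squarefree⟩

/-- A GENUINE non-real zero of `ζ_Q`, `Q = x² + 5y²` (`h(-20) = 2`), in the half-plane of ABSOLUTE CONVERGENCE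
`σ > 1` (where `epsteinZeta` is the convergent double series, no continuation or junk value involved):
Davenport–Heilbronn 1936 (tree `DavenportHeilbronn1936b_epstein_holds`, PROVED), `≥ C·T` such zeros with
`0 < t ≤ T`. [cite: Titchmarsh1986, §10.27] [cite: DavenportHeilbronn1936b, §6 Theorem] -/
theorem exists_epstein_zero_right : ∃ s : ℂ, 1 < s.re ∧ 0 < s.im ∧ epsteinZeta 1 0 5 s = 0 := by
  have hQ : IsPosDefForm ((1 : ℤ) : ℝ) ((0 : ℤ) : ℝ) ((5 : ℤ) : ℝ) := ⟨by norm_num, by norm_num⟩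
  have hd : IsFundamentalDiscriminant ((0 : ℤ) ^ 2 - 4 * 1 * 5) := by
    rw [show (0 : ℤ) ^ 2 - 4 * 1 * 5 = -20 by norm_num]; exact isFundamentalDiscriminant_neg_twenty
  have h2 : TwoFormClasses ((0 : ℤ) ^ 2 - 4 * 1 * 5) := by
    rw [show (0 : ℤ) ^ 2 - 4 * 1 * 5 = -20 by norm_num]; exact twoFormClasses_neg_twenty
  obtain ⟨-, C, hC, hev⟩ := DavenportHeilbronn1936b_epstein_holds 1 0 5 hQ hd h2
  obtain ⟨T, hT, hT1⟩ := (hev.and (eventually_ge_atTop 1)).exists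
  have hpos : (0 : ℝ) < ({s : ℂ | 1 < s.re ∧ 0 < s.im ∧ s.im ≤ T ∧
      epsteinZeta ((1 : ℤ) : ℝ) ((0 : ℤ) : ℝ) ((5 : ℤ) : ℝ) s = 0}.ncard : ℝ) :=
    lt_of_lt_of_le (by nlinarith) hT
  have hne : {s : ℂ | 1 < s.re ∧ 0 < s.im ∧ s.im ≤ T ∧
      epsteinZeta ((1 : ℤ) : ℝ) ((0 : ℤ) : ℝ) ((5 : ℤ) : ℝ) s = 0}.Nonempty :=
    Set.nonempty_of_ncard_ne_zero (by exact_mod_cast hpos.ne')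
  obtain ⟨s, hs1, hs2, -, hs4⟩ := hne
  exact ⟨s, hs1, hs2, by simpa using hs4⟩

/-- MODEL KILL 2 (the side-condition-free forms of X, cf. `rightZerosReal_iff`, `allZerosCriticalOrReal_iff`):
"every zero with `σ > 1/2` is real" FAILS for `ζ_{x²+5y²}` — by a zero in `σ > 1`, i.e. exactly where the
Euler product empties the picture for `ζ` (§2 `exactFirstBandWithoutLtOne_iff`). [cite: Titchmarsh1986, §10.27] -/
theorem not_rightZerosReal_epstein : ¬ ∀ s : ℂ, epsteinZeta 1 0 5 s = 0 → 1 / 2 < s.re → s.im = 0 := by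
  intro h
  obtain ⟨s, hs1, hs2, hs0⟩ := exists_epstein_zero_right
  exact absurd (h s hs0 (by linarith)) hs2.ne'

/-- [cite: Titchmarsh1986, §10.27] -/
theorem not_allZerosCriticalOrReal_epstein :
    ¬ ∀ s : ℂ, epsteinZeta 1 0 5 s = 0 → s.re = 1 / 2 ∨ s.im = 0 := by
  intro h
  obtain ⟨s, hs1, hs2, hs0⟩ := exists_epstein_zero_right
  rcases h s hs0 with h' | h'
  · linarith
  · exact hs2.ne' h'

/-- THE REAL-EXCEPTIONAL CLAUSE IS LIVE for Epstein zeta functions: `Q = x² + 64y²` has Stark parameter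
`k = √256/2 = 8 > 7.0556`, so EVERY analytic continuation `Z` of `ζ_Q` has a real zero `β ∈ (1/2, 1)`
(Bateman–Grosswald 1964, tree `BatemanGrosswald1964_realZero_holds`, PROVED), and a continuation exists (tree
`MontgomeryVaughan2007_epsteinContinuation_holds`, PROVED). For `ζ` this clause is void (§1): the DFG shape
transfers no content to `ζ` through it. [cite: Stark1967EpsteinZeros, §1] [cite: BatemanGrosswald1964, Theorem 3] -/
theorem exists_real_exceptional_zero_epstein :
    ∃ Z : ℂ → ℂ, IsEpsteinContinuation 1 0 64 Z ∧ ∃ σ : ℝ, 1 / 2 < σ ∧ σ < 1 ∧ Z σ = 0 := by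
  have hQ : IsPosDefForm (1 : ℝ) 0 64 := ⟨one_pos, by norm_num⟩
  obtain ⟨Z, hZ, -⟩ := MontgomeryVaughan2007_epsteinContinuation_holds 1 0 64 hQ
  have hk : (7.0556 : ℝ) < starkK 1 0 64 := by
    rw [starkK_one, show (4 : ℝ) * 64 - 0 ^ 2 = 16 ^ 2 by norm_num, Real.sqrt_sq (by norm_num)]
    norm_num
  exact ⟨Z, hZ, BatemanGrosswald1964_realZero_holds 1 0 64 hQ hk Z hZ⟩

/-- X'S SHAPE **IS** STARK'S THEOREM (tree `Stark1967_thm1_holds`, PROVED, `K` ineffective): for every positive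
definite `Q` with `k > K` and every continuation `Z` of `ζ_Q`, the zeros in the box `-1 < σ < 2`, `|t| ≤ 2k`
(`s ≠ 1`) lie on `σ = 1/2` OR ARE REAL — verbatim the DFG first-band shape "line plus finitely many real
exceptional resonances", realised by a Dirichlet series WITHOUT Euler product and WITH a genuine real pair
`β₁ = 1 - β₂`, `β₂ ∈ (1/2, 1)`. Moral for the route: the shape is what functional equation + domination by
`ζ(2s) + k^{1-2s}ζ(2s-1)Γ(s-1/2)√π/Γ(s)` produce; it is compatible with the failure of RH; exactness of the
first band is not an Euler-product phenomenon, emptiness of the real clause and of the HIGH off-line set is.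
[cite: Stark1967EpsteinZeros, Theorem 1] -/
theorem exactFirstBand_shape_epstein_low :
    ∃ K : ℝ, ∀ a b c : ℝ, IsPosDefForm a b c → K < starkK a b c →
      ∀ Z : ℂ → ℂ, IsEpsteinContinuation a b c Z →
        (∀ s ∈ starkBox (starkK a b c), s ≠ 1 → Z s = 0 → s.re = 1 / 2 ∨ s.im = 0) ∧
        ∃ β : ℝ, 1 / 2 < β ∧ β < 1 ∧ Z β = 0 := by
  obtain ⟨K, hK⟩ := Stark1967_thm1_holds
  refine ⟨K, fun a b c hQ hk Z hZ => ?_⟩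
  obtain ⟨-, β₁, β₂, -, -, h21, h22, -, -, hZ2, hall⟩ := hK a b c hQ hk Z hZ
  refine ⟨fun s hs h1 h0 => ?_, β₂, h21, h22, hZ2⟩
  rcases hall s hs h1 h0 with h | h | h
  · exact Or.inl h
  · exact Or.inr (by rw [h, ofReal_im])
  · exact Or.inr (by rw [h, ofReal_im])

end Models

/-! ## Targets (lead's stubs)

`payload.targets = []` at this cycle. PRE-TARGETS read from the lead's `PICKED.md` (2026-08-16T06:18Z: line `Sketch` =
`Cruxes/ExactFirstBand/Ideator3FirstLemmas.lean`, cards casimir-heat-trace + joukowski-hecke-reality; engine = the HEAT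
CONE `Z(u) = Σ_ρ m(ρ) e^{-uρ(1-ρ)}`), with the disprover's first reading — to be attacked when they become stubs:

* `HeatTraceIffExact : IsHalfLinePD heatTrace ↔ ExactFirstBand` — the bet. `⟸` is termwise (under X every
  `λ_ρ = β(1-β) + γ² > 0` is real, `Z` is a Laplace transform of a positive discrete measure); `⟹` is RH-strength.
  By `exactFirstBand_iff_riemannHypothesis` (§1) the left side is then RH-EQUIVALENT: no cheap kill, no cheap proof.
  Well-posedness: `heatTraceC u` is a `tsum` over the strip zeros of `m(ρ)e^{-uρ(1-ρ)}`, absolutely summable for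
  `Re u > 0` since `Re(ρ(1-ρ)) = β(1-β) + γ² ≥ γ²` and `|Im(ρ(1-ρ))| = |γ||1-2β| < |γ|` (zero counting `N(T) ≪ T log T`);
  junk `0` for `Re u ≤ 0`, never used there by the card's Props (checked: `IsHalfLinePD`, `HausdorffForm` with `k ≥ 1`,
  `VerticalBoundedness` with `σ > 0`).
* `HeatTraceBounded` — true and cheap (`|Z(t)| ≤ Z-majorant at t₀`, monotone in `t`).
* `GaussianExplicitFormula : ∀ u > 0, heatTraceC u = cexp (-u/4) * weilFunctional (gaussTest u)` — an EXACT identity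
  between two tree objects with fixed normalisations (`weilFunctional`, `weilMellin g s = ∫ g(t)e^{(s-1/2)t}dt`,
  `gaussTest u t = (4πu)^{-1/2}e^{-t²/(4u)}` so `ĝ_u(s) = e^{u(s-1/2)²}`, `ĝ_u(ρ) = e^{uρ(ρ-1)} · e^{u/4}`): the most
  KILLABLE stub of the line a priori (a factor `2`, a sign in the archimedean term, the pole terms
  `ĝ(0) + ĝ(1) = 2e^{u/4}`, or multiplicities on the zero side would each falsify it as typed). ATTACKED THIS CYCLE
  by ONE `kit compute` job, **j014946** (evidence `compute-j014946.json` on the item; script `gauss_explicit.py`):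
  mpmath at 30 digits, zero side `2e^{-u/4}Σ_{γ>0}e^{-uγ²}` from the first 120 ordinates (tail `< 1e-63`), Weil side
  `e^{-u/4}[ĝ(0)+ĝ(1) − Σ_n Λ(n)n^{-1/2}·2g_u(log n) + (1/2π)∫e^{-ut²}Re ψ(1/4+it/2)dt − g_u(0)log π]` in the tree's exact
  normalisation (`WeilExplicit.lean`): for `u = 0.002, 0.005, 0.01, 0.02, 0.05, 0.1` the two sides AGREE TO WORKING
  PRECISION (relative difference `4e-31 … 2e-23`, e.g. `u = 0.01`: both `0.29864846728467050674`). VERDICT: the stub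
  SURVIVES as typed — no normalisation slip; the lead may build on it (its proof is the explicit formula for a
  Gaussian test function, i.e. the extension of `explicit_formula_holds` from `IsWeilTest` to Schwartz tests with
  Gaussian decay — genuine analytic work, not a bet).
* `TemperatureRigidity`, `HausdorffForm`, `VerticalBoundedness` — real-analysis reformulations of the bet (each `⟺ X`,
  hence RH-equivalent; nothing cheap). Paper check of `VerticalBoundedness (⟸)`: with `λ_ρ = a + ib`,
  `a = β(1-β) + γ²`, `b = γ(1-2β)`, the term of `Z(σ+iτ)` has modulus `m e^{-σa + τb}`; `λ_{1-ρ} = λ_ρ` and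
  `λ_{ρ̄} = λ̄_ρ`. If the off-line set is FINITE and non-empty, the top growth rate `B = max b > 0` is attained, the
  coefficient trigonometric polynomial `Σ_{b_ρ = B} 2m(ρ)e^{-σa_ρ}e^{-iτa_ρ}` has POSITIVE coefficients and distinct
  frequencies, hence is almost periodic and not identically small — `Z(σ+iτ)` is unbounded: fine. If the off-line
  set is INFINITE (¬ rung #5) the sup of the rates need not be attained and a mean-value argument is needed; flag for
  the lead: the typed `⟸` must cover that case (it is exactly the case a disproof of X would live in, §1).
-/

end Summit.RiemannHypothesis.RiemannHypothesis.Cruxes.ExactFirstBand.Disproof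

end
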